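import Literature.MathematicalPhysics.QuantumFieldTheory.Balaban1983to89.B9Ineq368PPrime

/-!
# `Balaban1983to89.B8Ineq192Op` — B8 (1.92) «|(H′X)(x)|, |(∇H′X)(x)| ≦ B′₀[1, (Lʲη)⁻¹]|X| for x ∈ Ω_j» in the
# block-majorant OPERATOR form of [4] (2.51) — no composition dictionary — together with the Δ-entry
# «ΔH′ ≺ B′₀(Lʲη)⁻²» used on p. 93, KERNEL-CHECKED from Theorem 3.1/3.2-shaped letters and Lemma 2.1

statement-level skeleton of published theorems with citation tags; proofs where landed; nothing here is a claim
about the Yang–Mills mass gap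

CITATION HEADER (lean-in-tree rule 2026-08-18; mega-formalization `lit-balaban`, reader/typer seat r05 gen 13, free
target under protocol G.5-34(d); SKELETON row `B8.Eq1.91` = (1.91)–(1.92), member (1.92)).  T. Bałaban, *Spaces of
regular gauge field configurations on a lattice and gauge fixing conditions*, Commun. Math. Phys. **99** (1985)
75–102 `[Balaban1985RegularSpaces]` ("B8"; held `paper:balaban1985-cmp99-regular-spaces-gauge-fixing`, journal page =
PDF page + 74), read on the page renders `…-p017-x2.png` (p. 91), `…-p018-x2.png` (p. 92), `…-p019-x2.png` (p. 93):
p. 91 [PDF 17], verbatim: «Let us introduce the operators H′ = G′²Q′\*(Q′G′²Q′\*)⁻¹, G′ = (Δ + Q′\*aQ′)⁻¹. (1.91) They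
were investigated in [4], and the following inequality can be obtained from the results of this paper: |(H′X)(x)|,
|(∇H′X)(x)| ≦ B′₀[1, (Lʲη)⁻¹]|X| for x ∈ Ω_j, (1.92)»; p. 92 [PDF 18]: «where (H′X)(x) = Σ_{y′∈𝔅_k}(L^{j′}η)^dH′(x,
y′)X(y′), and B′₀ is an absolute constant (depending on d and L only).»; p. 92 (1.93) contains the term
«Rg(i ad_{λ−H′D′(u₁,λ)})Δ(λ − H′D′(u₁, λ))» and p. 93 [PDF 19] l. 1–3: «This and (1.96) implies that the operator
(I + RVR)⁻¹ applied to the last term in (1.93) gives a term bounded by O(1)B₁(α₀ + α₁)α₄(Lʲη)⁻² on Ω_j. We get the same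
bound for the term with D\*A (but with RD\*A subtracted), and with ΔH′D′(u₁, λ).» — the last clause uses a bound on
ΔH′ of the shape (Lʲη)⁻², which (1.92) does not display (this file's `ineq192_op` third conjunct).  [4] = T. Bałaban,
*Propagators for lattice gauge theories in a background field*, Commun. Math. Phys. **99** (1985) 389–434
`[Balaban1985BackgroundPropagators]` ("B9"; journal page = PDF page + 388), results used (renders `…-p009/p010-x2.png`):
Theorem 3.1 (3.42) p. 397 «|(G′(U)λ)(x)|, |(∇_UG′(U)λ)(x)|, |(G′(U)∇\*_Uλ)(x)|, |(Δ_UG′(U)λ)(x)| ≦ B₀[(Lʲη)², Lʲη, Lʲη, 1]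
e^{−δ₀d(y,y′)}|λ| for x ∈ Δ(y), y ∈ Λ_j, supp λ ⊂ Δ(y′)», Theorem 3.2 (3.48) p. 398 «|(Q′(U)G′²(U)Q′\*(U))⁻¹(y, y′)| ≦
B₀(Lʲη)⁻⁴(L^{j′}η)^{−d}e^{−δ₀d(y,y′)}», the remark p. 398 «Using Lemma 2.1 in [4] we may replace the factor (Lʲη)^α by
(Lʲη)^β(L^{j′}η)^γ with β + γ = α», and Lemma 2.1 of T. Bałaban, *Propagators and renormalization transformations for
lattice gauge theories. II*, Commun. Math. Phys. **96** (1984) 223–250 `[Balaban1984PropagatorsII]` ("B6"), p. 234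
(2.61) «sup_{y∈𝔅} Σ_{y′∈𝔅} e^{−αδ₀d(y,y′)} ≦ c₁(α)», with the composition rule (2.52)–(2.55) p. 232 and the triangle
inequality (2.54).

STATUS IN THE TREE BEFORE THIS FILE (read first; nothing below restates it).  `B8Ineq192` (b2b-balaban-b08) proves
(1.92) by three-factor multiscale power counting of KERNELS (`ineq192_kernel`, `ineq192_blocks`, `ineq192_of_thms31to32`,
`ineq192_family`, `ineq192_onOmega`) MODULO its hypothesis (i), the kernel-composition dictionary `HDominated`
(«sup_{x∈Δ(y)}|(D^aH′X)(x)| is dominated by the triple sum …; neither is displayed in print») and the test-function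
dictionary `B9Ineq349.ObservedBy`; it has the two printed entries (H′, ∇H′) only.  `B8Eq191Hprime` (r05 g10) has the
DEFINITION (1.91) with bodies at the Hilbert-space level; `B8Ineq192GaugeInv` (p40 g9) the gauge invariance of the
(1.92) shapes.  On the [4] side r06 g6's `B9Ineq368PPrime` set up the block-majorant LETTER calculus («W carries sites
AND bonds (and 𝔅)», all letters in one `Module.End ℝ (W → ℝ)`, derivative letters `D`, `Ds` so that (3.42)₂,₃ are
majorants of the products `D * G`, `G * Ds`) and proved (3.49) in operator form WITHOUT dictionary (`ineq349_op`); the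
composition/transfer lemmas are `B9Ineq366CPrime.hasMajorant_comp_decay`, `hasMajorant_local_mul`,
`hasMajorant_rate_mono`, `scaleTransfer_one`, `B9Ineq368PPrime.scaleTransfer_mul`.

WHAT THIS FILE PROVES (theorems only; 0 `def`, 0 new facts, 0 sorry).  Same setting and letters as `ineq349_op`:
G = G′(U) ≺ B₀(Lʲη)²e^{−δd} ((3.42)₁), D·G ≺ B₀Lʲηe^{−δd} ((3.42)₂), Lap·G ≺ B₀·1·e^{−δd} ((3.42)₄, the Laplacian
letter `Lap`), Cinv = (Q′G′²Q′\*)⁻¹ ≺ B₁(Lʲη)⁻⁴e^{−δd} ((3.48), operator form), Qs = Q′\* block-local with norm κ_Q, the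
scale transfers of (Lʲη)² and (Lʲη)⁻⁴ at exponent α (constant Λ ≧ 1), (2.61) at β, (2.54), output rate ρ ≧ 0 with
ρ + (2α + β)δ₀ ≦ δ; H′ := G·G·Qs·Cinv (the word (1.91)).
* §1 `hasMajorant_wordH` — the word X·G·Q′\*·(Q′G′²Q′\*)⁻¹ with a generic left letter X ≺ B_X w_X e^{−δd}: majorant
  κ_QB_XB₀B₁Λ³c₁(β)² · w_X(y)(Lʲη)⁻² · e^{−ρd} (two compositions: (Lʲη)²·(Lʲη)⁻⁴ transferred at 2α).
* §2 **`ineq192_op`** — (1.92) IN OPERATOR FORM, NO DICTIONARY, with the Δ-entry: **H′ ≺ κ_H·e^{−ρd}**,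
  **D·H′ ≺ κ_H·(Lʲη)⁻¹·e^{−ρd}**, **Lap·H′ ≺ κ_H·(Lʲη)⁻²·e^{−ρd}**, κ_H = κ_QB₀²B₁Λ³c₁(β)² — the exponents 2+2−4 = 0,
  1+2−4 = −1, 0+2−4 = −2 are the printed «[1, (Lʲη)⁻¹]» and the p. 93 (Lʲη)⁻².
* §3 FUNCTION-LEVEL consequences ((2.61) once more at the rate ρ): `bound_of_majorant` (generic: T ≺ κP(y)e^{−ρd} ⇒
  |(TX)(v)| ≦ κc₁P(y)|X| for v in the block of y), **`ineq192_blocks_op`** (|(H′X)(v)| ≦ B′₀|X|, |(∇H′X)(v)| ≦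
  B′₀(L^{j(v)}η)⁻¹|X|, |(ΔH′X)(v)| ≦ B′₀(L^{j(v)}η)⁻²|X| with **B′₀ = κ_H·c₁(1−α′)** — j(v) = the scale of the block of
  v; the third line reads |ΔH′X|₍₋₂₎ ≦ B′₀|X|, the input of the p. 93 clause «and with ΔH′D′(u₁, λ)»), and the printed
  «for x ∈ Ω_j» reading `inv_len_pow_le` (a point of Ω_j lies in a block of scale j(v) ≧ j and (L^{j(v)}η)⁻ⁿ ≦
  (Lʲη)⁻ⁿ — B9 p. 397 «For α negative we can take Ω_j instead of Ω_j∖Ω_{j+1}»), assembled in `ineq192_onOmega_op`.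

HONEST SCOPE / NOT CLAIMED.  (i) Theorems 3.1/3.2 and Lemma 2.1 are hypotheses of printed shape (letters); the
identification of the letters `D`, `Lap` with B8's covariant derivative ∇^η_{U₀} (1.1) and Laplacian on a concrete
carrier, and of the block map on bonds, is the reader's (as in `B9Ineq368PPrime`); «|X|» is the sup norm of the coarse
function X on 𝔅_k (points of W of their own blocks) — the coarse weight (L^{j′}η)^d of p. 92's display is absorbed in
the operator form exactly as in (3.49)'s.  (ii) OPERATOR (block L^∞ → L^∞) form; B8Ineq192's kernel form is neither
implied by nor implies this one without the dictionaries.  (iii) The Δ-entry is NOT displayed in (1.92); it is the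
located input of the p. 93 sentence quoted above (same derivation, (3.42)₄ instead of (3.42)₁,₂) — a reading, recorded
in the docstrings, not an erratum.  (iv) Rates: ρ any rate with the stated margin below the common input rate δ
(print's B′₀ absorbs c₁ at the corresponding exponents; cf. `B9Ineq349.rates_349`).  NOTHING of the series'
end-statement (ultraviolet stability) is asserted; value = the cell's (1.92) certification freed of its composition
dictionary plus the un-displayed Δ-entry, NOT summit progress.

RELATED IN THE TREE, NOT DUPLICATED (searched 2026-08-21T22:52Z: `ls Balaban1983to89/ | grep -i 192` = B8Ineq192,
B8Ineq192GaugeInv, B15Claim192Flow; `grep Ineq192Op FILED.md` = 0): `B8Ineq192.*` (kernel form, modulo dictionary —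
not modified), `B9Ineq368PPrime.ineq349_op`/`hasMajorant_word349` (the (3.49) analogue; its 5-letter word has two local
letters, H′'s 4-letter word one — hence the separate §1), `B9Ineq366CPrime.*` composition lemmas (USED BY NAME),
`B8Eq191Hprime.Hp` (Hilbert-space definition of (1.91), other formalism), `B8Ineq198R` (r05 g13, (1.98) R-half by the
same function-level route).
-/

noncomputable section

namespace Literature.MathematicalPhysics.QuantumFieldTheory.Balaban1983to89.B8Ineq192Op

open Literature.MathematicalPhysics.QuantumFieldTheory.Balaban1983to89.B6RandomWalk (HasMajorant Ineq261 Triangle254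
  hasMajorant_mono)
open Literature.MathematicalPhysics.QuantumFieldTheory.Balaban1983to89.B9Thm34Ext (toB6)
open Literature.MathematicalPhysics.QuantumFieldTheory.Balaban1983to89.B9Ineq347 (ScaleTransfer glob347_entry1_of_342)
open Literature.MathematicalPhysics.QuantumFieldTheory.Balaban1983to89.B9Ineq366CPrime (hasMajorant_comp_decay
  hasMajorant_local_mul hasMajorant_rate_mono scaleTransfer_one)
open Literature.MathematicalPhysics.QuantumFieldTheory.Balaban1983to89.B9Ineq368PPrime (scaleTransfer_mul)

/-! ## §1  The word `X·G′·Q′*·(Q′G′²Q′*)⁻¹` with a generic left letter -/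

section Word

variable {g : B9.Geometry} [Fintype g.Site] [DecidableEq g.Site] {R : ℝ} {H : Prop} {W : Type}

/-- **The word X·G′·Q′\*·(Q′G′²Q′\*)⁻¹ of (1.91)** (H′ = G′²Q′\*(Q′G′²Q′\*)⁻¹ with its outer G′ replaced by a generic
letter X ∈ {G′, ∇G′, ΔG′}).  Letters: X ≺ B_X·w_X(y)·e^{−δd} (w_X ≧ 0), G ≺ B₀(Lʲη)²e^{−δd} ((3.42)₁), Qs = Q′\*
block-local with norm κ_Q, Cinv ≺ B₁(Lʲη)⁻⁴e^{−δd} ((3.48) in operator form); the scale transfers of (Lʲη)² and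
(Lʲη)⁻⁴ at exponent α with constant Λ ≧ 1 (p. 398 remark), (2.61) at β, (2.54); output rate ρ ≧ 0 with
ρ + (2α + β)δ₀ ≦ δ.  Conclusion: X·G·Qs·Cinv ≺ κ_QB_XB₀B₁Λ³c₁(β)² · w_X(y)·(Lʲη)⁻² · e^{−ρd(y,y′)} — two compositions
([4] (2.52)–(2.55)), the inner weight (Lʲη)²·(Lʲη)⁻⁴ = (Lʲη)⁻² transferred at 2α (constant Λ²), the local letter free.
[cite: Balaban1985RegularSpaces, (1.91)–(1.92) p.91; Balaban1985BackgroundPropagators, (3.42) p.397, (3.48) p.398, remark after (3.47) p.398; Balaban1984PropagatorsII, (2.52)–(2.55) p.232, Lemma 2.1 p.234] -/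
theorem hasMajorant_wordH (blk : W → g.Site) (d : ℕ) (δ₀ δ α β ρ Λ κQ BX B₀ B₁ : ℝ) (wX : g.Site → ℝ)
    (hwX : ∀ a, 0 ≤ wX a) (hκQ : 0 ≤ κQ) (hBX : 0 ≤ BX) (hB₀ : 0 ≤ B₀) (hB₁ : 0 ≤ B₁) (hΛ : 1 ≤ Λ)
    (hρ : 0 ≤ ρ) (hα : 0 ≤ α) (hβ : 0 ≤ β) (hδ₀ : 0 ≤ δ₀) (hr : ρ + (2 * α + β) * δ₀ ≤ δ)
    (hdnn : ∀ a b : g.Site, 0 ≤ g.dist a b) (htri : Triangle254 (toB6 g R H)) (hlen : ∀ y : g.Site, 0 < g.len y)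
    (h261 : Ineq261 d (toB6 g R H) δ₀ β)
    (hT2 : ScaleTransfer g δ₀ α Λ (fun a => g.len a ^ 2)) (hT4 : ScaleTransfer g δ₀ α Λ (fun a => (g.len a ^ 4)⁻¹))
    {X G Qs Cinv : Module.End ℝ (W → ℝ)}
    (hX : HasMajorant (g := toB6 g R H) blk X (fun a b => BX * wX a * Real.exp (-(δ * g.dist a b))))
    (hG : HasMajorant (g := toB6 g R H) blk G (fun a b => B₀ * g.len a ^ 2 * Real.exp (-(δ * g.dist a b))))
    (hQs : HasMajorant (g := toB6 g R H) blk Qs (fun a b : g.Site => if a = b then κQ else 0))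
    (hCinv : HasMajorant (g := toB6 g R H) blk Cinv
      (fun a b => B₁ * (g.len a ^ 4)⁻¹ * Real.exp (-(δ * g.dist a b)))) :
    HasMajorant (g := toB6 g R H) blk (X * G * Qs * Cinv)
      (fun a b => (κQ * BX * B₀ * B₁ * Λ ^ 3 * B6.c1 d δ₀ β ^ 2) * (wX a * (g.len a ^ 2)⁻¹) *
        Real.exp (-(ρ * g.dist a b))) := by
  have hw2 : ∀ a : g.Site, 0 ≤ g.len a ^ 2 := fun a => sq_nonneg _
  have hw4 : ∀ a : g.Site, 0 ≤ (g.len a ^ 4)⁻¹ := fun a => inv_nonneg.mpr (by positivity)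
  have hΛ0 : 0 ≤ Λ := le_trans zero_le_one hΛ
  have hρδ : ρ ≤ δ := by nlinarith
  have hr1 : ρ + (α + β) * δ₀ ≤ δ := by nlinarith
  have hr2 : ρ + ((α + α) + β) * δ₀ ≤ δ := by nlinarith
  -- Q′* · (Q′G′²Q′*)⁻¹ : block-local × decaying, no rate loss
  have hK : ∀ a b : g.Site, 0 ≤ B₁ * (g.len a ^ 4)⁻¹ * Real.exp (-(δ * g.dist a b)) := fun a b =>
    mul_nonneg (mul_nonneg hB₁ (hw4 a)) (Real.exp_nonneg _)
  have hQC0 := hasMajorant_local_mul (R := R) (H := H) blk κQ hK hQs hCinv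
  have hQC : HasMajorant (g := toB6 g R H) blk (Qs * Cinv)
      (fun a b => (κQ * B₁) * (g.len a ^ 4)⁻¹ * Real.exp (-(δ * g.dist a b))) :=
    hasMajorant_mono (g := toB6 g R H) blk hQC0 fun a b => le_of_eq (by ring)
  -- weaken its rate to the output rate ρ
  have hQCρ := hasMajorant_rate_mono (R := R) (H := H) blk (κQ * B₁) (fun a => (g.len a ^ 4)⁻¹)
    (mul_nonneg hκQ hB₁) hw4 hρδ hdnn hQC
  -- G · (Q′* Cinv): one composition, transfer of (Lʲη)⁻⁴ at α
  have hGQC := hasMajorant_comp_decay (R := R) (H := H) blk d δ₀ α β ρ δ Λ B₀ (κQ * B₁)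
    (fun a => g.len a ^ 2) (fun a => (g.len a ^ 4)⁻¹) hw2 hw4 hΛ0 hB₀ (mul_nonneg hκQ hB₁) hρ hr1 hdnn htri
    hT4 h261 hG hQCρ
  -- X · (G Q′* Cinv): second composition, transfer of (Lʲη)²(Lʲη)⁻⁴ at 2α
  have hT24 : ScaleTransfer g δ₀ (α + α) (Λ * Λ) (fun a => g.len a ^ 2 * (g.len a ^ 4)⁻¹) :=
    scaleTransfer_mul hw2 hw4 hT2 hT4
  have hw24 : ∀ a : g.Site, 0 ≤ g.len a ^ 2 * (g.len a ^ 4)⁻¹ := fun a => mul_nonneg (hw2 a) (hw4 a)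
  have hXGQC := hasMajorant_comp_decay (R := R) (H := H) blk d δ₀ (α + α) β ρ δ (Λ * Λ) BX
    (B₀ * (κQ * B₁) * Λ * B6.c1 d δ₀ β) wX (fun a => g.len a ^ 2 * (g.len a ^ 4)⁻¹) hwX hw24
    (mul_nonneg hΛ0 hΛ0) hBX (by
      have hc : 0 ≤ B6.c1 d δ₀ β := B6RandomWalk.c1_nonneg d δ₀ β
      positivity) hρ hr2 hdnn htri hT24 h261 hX hGQC
  have hassoc : X * G * Qs * Cinv = X * (G * (Qs * Cinv)) := by noncomm_ring
  rw [hassoc]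
  refine hasMajorant_mono (g := toB6 g R H) blk hXGQC fun a b => le_of_eq ?_
  have ha : g.len a ≠ 0 := (hlen a).ne'
  have hid : g.len a ^ 2 * (g.len a ^ 4)⁻¹ = (g.len a ^ 2)⁻¹ := by
    field_simp
  rw [hid]
  ring

end Word

/-! ## §2  (1.92) in operator form, with the Δ-entry of p. 93 -/

section Ineq192

variable {g : B9.Geometry} [Fintype g.Site] [DecidableEq g.Site] {R : ℝ} {H : Prop} {W : Type}

/-- **(1.92) IN THE BLOCK-MAJORANT OPERATOR FORM OF [4] (2.51), NO COMPOSITION DICTIONARY, WITH THE Δ-ENTRY** (B8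
p. 91: «|(H′X)(x)|, |(∇H′X)(x)| ≦ B′₀[1, (Lʲη)⁻¹]|X| for x ∈ Ω_j, (1.92)» — «can be obtained from the results of
[4]»; p. 93 l. 1–3 «… and with ΔH′D′(u₁, λ)»).  For H′ = G·G·Qs·Cinv = G′²Q′\*(Q′G′²Q′\*)⁻¹ ((1.91)) in the letters of
`B9Ineq368PPrime.ineq349_op` — G ≺ B₀(Lʲη)²e^{−δd} ((3.42)₁), D·G ≺ B₀Lʲηe^{−δd} ((3.42)₂), Lap·G ≺ B₀e^{−δd}
((3.42)₄), Cinv ≺ B₁(Lʲη)⁻⁴e^{−δd} ((3.48)), Q′\* block-local with norm κ_Q ≧ 0, the scale transfers of (Lʲη)², (Lʲη)⁻⁴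
at exponent α (constant Λ ≧ 1), (2.61) at β, (2.54), Lʲη > 0 — and every output rate ρ ≧ 0 with ρ + (2α + β)δ₀ ≦ δ:
**H′ ≺ κ_H·e^{−ρd}**, **D·H′ ≺ κ_H·(Lʲη)⁻¹·e^{−ρd}**, **Lap·H′ ≺ κ_H·(Lʲη)⁻²·e^{−ρd}** with
**κ_H = κ_Q·B₀²·B₁·Λ³·c₁(β)²** — the printed prefactors [1, (Lʲη)⁻¹] (exponents 2+2−4, 1+2−4) and the p. 93 exponent
0+2−4 = −2.
[cite: Balaban1985RegularSpaces, (1.91)–(1.92) pp.91–92, p.93 l.1–3; Balaban1985BackgroundPropagators, Thm 3.1 (3.42) p.397, Thm 3.2 (3.48) p.398, remark after (3.47) p.398; Balaban1984PropagatorsII, (2.52)–(2.55) p.232, Lemma 2.1 p.234] -/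
theorem ineq192_op (blk : W → g.Site) (d : ℕ) (δ₀ δ α β ρ Λ κQ B₀ B₁ : ℝ)
    (hκQ : 0 ≤ κQ) (hB₀ : 0 ≤ B₀) (hB₁ : 0 ≤ B₁) (hΛ : 1 ≤ Λ) (hρ : 0 ≤ ρ) (hα : 0 ≤ α) (hβ : 0 ≤ β)
    (hδ₀ : 0 ≤ δ₀) (hr : ρ + (2 * α + β) * δ₀ ≤ δ)
    (hdnn : ∀ a b : g.Site, 0 ≤ g.dist a b) (htri : Triangle254 (toB6 g R H)) (hlen : ∀ y : g.Site, 0 < g.len y)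
    (h261 : Ineq261 d (toB6 g R H) δ₀ β)
    (hT2 : ScaleTransfer g δ₀ α Λ (fun a => g.len a ^ 2)) (hT4 : ScaleTransfer g δ₀ α Λ (fun a => (g.len a ^ 4)⁻¹))
    {G D Lap Qs Cinv : Module.End ℝ (W → ℝ)}
    (hQs : HasMajorant (g := toB6 g R H) blk Qs (fun a b : g.Site => if a = b then κQ else 0))
    (hG : HasMajorant (g := toB6 g R H) blk G (fun a b => B₀ * g.len a ^ 2 * Real.exp (-(δ * g.dist a b))))
    (hDG : HasMajorant (g := toB6 g R H) blk (D * G) (fun a b => B₀ * g.len a * Real.exp (-(δ * g.dist a b))))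
    (hLapG : HasMajorant (g := toB6 g R H) blk (Lap * G) (fun a b => B₀ * 1 * Real.exp (-(δ * g.dist a b))))
    (hCinv : HasMajorant (g := toB6 g R H) blk Cinv
      (fun a b => B₁ * (g.len a ^ 4)⁻¹ * Real.exp (-(δ * g.dist a b)))) :
    HasMajorant (g := toB6 g R H) blk (G * G * Qs * Cinv)
        (fun a b => (κQ * B₀ ^ 2 * B₁ * Λ ^ 3 * B6.c1 d δ₀ β ^ 2) * Real.exp (-(ρ * g.dist a b))) ∧
      HasMajorant (g := toB6 g R H) blk (D * (G * G * Qs * Cinv))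
        (fun a b => (κQ * B₀ ^ 2 * B₁ * Λ ^ 3 * B6.c1 d δ₀ β ^ 2) * (g.len a)⁻¹ * Real.exp (-(ρ * g.dist a b))) ∧
      HasMajorant (g := toB6 g R H) blk (Lap * (G * G * Qs * Cinv))
        (fun a b => (κQ * B₀ ^ 2 * B₁ * Λ ^ 3 * B6.c1 d δ₀ β ^ 2) * (g.len a ^ 2)⁻¹ *
          Real.exp (-(ρ * g.dist a b))) := by
  have hw2 : ∀ a : g.Site, 0 ≤ g.len a ^ 2 := fun a => sq_nonneg _
  have hw1 : ∀ a : g.Site, 0 ≤ g.len a := fun a => (hlen a).le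
  -- the three words with left letters G, D·G, Lap·G
  have e0 := hasMajorant_wordH (R := R) (H := H) blk d δ₀ δ α β ρ Λ κQ B₀ B₀ B₁ (fun a => g.len a ^ 2) hw2 hκQ hB₀
    hB₀ hB₁ hΛ hρ hα hβ hδ₀ hr hdnn htri hlen h261 hT2 hT4 hG hG hQs hCinv
  have e1 := hasMajorant_wordH (R := R) (H := H) blk d δ₀ δ α β ρ Λ κQ B₀ B₀ B₁ (fun a => g.len a) hw1 hκQ hB₀
    hB₀ hB₁ hΛ hρ hα hβ hδ₀ hr hdnn htri hlen h261 hT2 hT4 hDG hG hQs hCinv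
  have hLapG' : HasMajorant (g := toB6 g R H) blk (Lap * G)
      (fun a b => B₀ * (fun _ : g.Site => (1 : ℝ)) a * Real.exp (-(δ * g.dist a b))) :=
    hasMajorant_mono (g := toB6 g R H) blk hLapG fun a b => le_of_eq rfl
  have e2 := hasMajorant_wordH (R := R) (H := H) blk d δ₀ δ α β ρ Λ κQ B₀ B₀ B₁ (fun _ => (1 : ℝ))
    (fun _ => zero_le_one) hκQ hB₀ hB₀ hB₁ hΛ hρ hα hβ hδ₀ hr hdnn htri hlen h261 hT2 hT4 hLapG' hG hQs hCinv
  have o1 : D * (G * G * Qs * Cinv) = D * G * G * Qs * Cinv := by noncomm_ring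
  have o2 : Lap * (G * G * Qs * Cinv) = Lap * G * G * Qs * Cinv := by noncomm_ring
  refine ⟨?_, ?_, ?_⟩
  · refine hasMajorant_mono (g := toB6 g R H) blk e0 fun a b => le_of_eq ?_
    have ha : g.len a ≠ 0 := (hlen a).ne'
    field_simp
  · rw [o1]
    refine hasMajorant_mono (g := toB6 g R H) blk e1 fun a b => le_of_eq ?_
    have ha : g.len a ≠ 0 := (hlen a).ne'
    field_simp
  · rw [o2]
    refine hasMajorant_mono (g := toB6 g R H) blk e2 fun a b => le_of_eq ?_
    ring

end Ineq192

/-! ## §3  Function-level consequences: the printed sup bounds and the «for x ∈ Ω_j» reading -/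

section Function

variable {g : B9.Geometry} [Fintype g.Site] {R : ℝ} {H : Prop} {W : Type}

/-- **From a majorant to the printed bound on functions** ([4] (2.51) read as in (3.42)/(1.92): «|(TX)(x)| ≦ … |X| for
x ∈ Δ(y)»).  If T ≺ κ·P(y)·e^{−ρd(y,y′)} (κ ≧ 0, P ≧ 0), (2.61) holds at the rate ρ (exponent 1 − α′, with 0 ≦ α′ρ so
that the constant weight 1 transfers trivially) then |X| ≦ N implies |(TX)(v)| ≦ κ·c₁(1−α′)·P(y)·N for v in the block
of y (X = Σ_{y′}Δ(y′)X, block by block, (2.61) — the route of `B9Ineq347.glob347_entry1_of_342` with w ≡ 1).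
[cite: Balaban1985RegularSpaces, (1.92) p.91; Balaban1985BackgroundPropagators, (3.42) p.397; Balaban1984PropagatorsII, (2.51)–(2.52) p.232, (2.61) p.234] -/
theorem bound_of_majorant (blk : W → g.Site) (d : ℕ) (ρ α' κ N : ℝ) (P : g.Site → ℝ) (hκ : 0 ≤ κ)
    (hP : ∀ y, 0 ≤ P y) (hN : 0 ≤ N) (hαρ : 0 ≤ α' * ρ) (hdnn : ∀ a b : g.Site, 0 ≤ g.dist a b)
    (h261 : Ineq261 d (toB6 g R H) ρ (1 - α'))
    {T : Module.End ℝ (W → ℝ)}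
    (hT : HasMajorant (g := toB6 g R H) blk T (fun a b => κ * P a * Real.exp (-(ρ * g.dist a b))))
    (X : W → ℝ) (hX : ∀ x, |X x| ≤ N) (v : W) :
    |T X v| ≤ κ * B6.c1 d ρ (1 - α') * P (blk v) * N := by
  have hST : ScaleTransfer g ρ α' 1 (fun _ : g.Site => (1 : ℝ)) := scaleTransfer_one hαρ hdnn
  have hX1 : ∀ x, |X x| ≤ (fun _ : g.Site => (1 : ℝ)) (blk x) * N := fun x => by simpa using hX x
  have h := glob347_entry1_of_342 (R := R) (H := H) blk d ρ α' κ 1 N P (fun _ => (1 : ℝ)) hκ hP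
    (fun _ => zero_le_one) hN h261 hST hT X hX1 v
  simpa only [mul_one] using h

/-- **(1.92) at the function level, in block form, with the Δ-entry** (B8 p. 91 «|(H′X)(x)|, |(∇H′X)(x)| ≦ B′₀[1,
(Lʲη)⁻¹]|X|»; p. 93 «and with ΔH′D′(u₁, λ)»): from the three operator majorants of `ineq192_op` (any κ_H ≧ 0) and
(2.61) at the rate ρ: for every coarse function X with |X| ≦ N and every v in the block of y ∈ Λ_{j(v)},
|(H′X)(v)| ≦ B′₀N, |(∇H′X)(v)| ≦ B′₀(L^{j(v)}η)⁻¹N, |(ΔH′X)(v)| ≦ B′₀(L^{j(v)}η)⁻²N with **B′₀ = κ_H·c₁(1−α′)**; the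
third line is |ΔH′X|₍₋₂₎ ≦ B′₀|X| in the norm (3.41)/(p. 86).
[cite: Balaban1985RegularSpaces, (1.92) pp.91–92, p.93 l.1–3; Balaban1985BackgroundPropagators, (3.41) p.397; Balaban1984PropagatorsII, Lemma 2.1 (2.61) p.234] -/
theorem ineq192_blocks_op (blk : W → g.Site) (d : ℕ) (ρ α' κH N : ℝ) (hκH : 0 ≤ κH) (hN : 0 ≤ N)
    (hαρ : 0 ≤ α' * ρ) (hdnn : ∀ a b : g.Site, 0 ≤ g.dist a b) (hlen : ∀ y : g.Site, 0 < g.len y)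
    (h261 : Ineq261 d (toB6 g R H) ρ (1 - α'))
    {Hp DHp LapHp : Module.End ℝ (W → ℝ)}
    (h0 : HasMajorant (g := toB6 g R H) blk Hp (fun a b => κH * Real.exp (-(ρ * g.dist a b))))
    (h1 : HasMajorant (g := toB6 g R H) blk DHp (fun a b => κH * (g.len a)⁻¹ * Real.exp (-(ρ * g.dist a b))))
    (h2 : HasMajorant (g := toB6 g R H) blk LapHp
      (fun a b => κH * (g.len a ^ 2)⁻¹ * Real.exp (-(ρ * g.dist a b))))
    (X : W → ℝ) (hX : ∀ x, |X x| ≤ N) (v : W) :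
    |Hp X v| ≤ κH * B6.c1 d ρ (1 - α') * N ∧
      |DHp X v| ≤ κH * B6.c1 d ρ (1 - α') * (g.len (blk v))⁻¹ * N ∧
      |LapHp X v| ≤ κH * B6.c1 d ρ (1 - α') * (g.len (blk v) ^ 2)⁻¹ * N := by
  have h0' : HasMajorant (g := toB6 g R H) blk Hp
      (fun a b => κH * (fun _ : g.Site => (1 : ℝ)) a * Real.exp (-(ρ * g.dist a b))) :=
    hasMajorant_mono (g := toB6 g R H) blk h0 fun a b => by simp
  have b0 := bound_of_majorant (R := R) (H := H) blk d ρ α' κH N (fun _ => (1 : ℝ)) hκH (fun _ => zero_le_one) hN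
    hαρ hdnn h261 h0' X hX v
  have b1 := bound_of_majorant (R := R) (H := H) blk d ρ α' κH N (fun a => (g.len a)⁻¹) hκH
    (fun y => inv_nonneg.mpr (hlen y).le) hN hαρ hdnn h261 h1 X hX v
  have b2 := bound_of_majorant (R := R) (H := H) blk d ρ α' κH N (fun a => (g.len a ^ 2)⁻¹) hκH
    (fun y => inv_nonneg.mpr (sq_nonneg _)) hN hαρ hdnn h261 h2 X hX v
  refine ⟨by simpa only [mul_one] using b0, ?_, ?_⟩
  · simpa only [mul_assoc] using b1
  · simpa only [mul_assoc] using b2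

omit [Fintype g.Site] in
/-- **The «for x ∈ Ω_j» reading of (1.92)** (B8 p. 91) — a point of Ω_j lies in a block Δ(y), y ∈ Λ_{j(y)} with
j(y) ≧ j, and for L ≧ 1, η > 0 the block prefactor is the smaller one: (L^{j(y)}η)⁻ⁿ ≦ (Lʲη)⁻ⁿ (B9 p. 397: «For α
negative we can take Ω_j instead of Ω_j∖Ω_{j+1} above»).
[cite: Balaban1985RegularSpaces, (1.92) p.91; Balaban1985BackgroundPropagators, (3.41) p.397] -/
theorem inv_len_pow_le (hL : 1 ≤ g.L) (hη : 0 < g.eta) {j : ℕ} {y : g.Site} (hj : j ≤ g.scale y) (n : ℕ) :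
    (g.len y ^ n)⁻¹ ≤ ((g.L ^ j * g.eta) ^ n)⁻¹ := by
  have hL0 : 0 < g.L := lt_of_lt_of_le one_pos hL
  have hpos : 0 < g.L ^ j * g.eta := mul_pos (pow_pos hL0 _) hη
  have hle : g.L ^ j * g.eta ≤ g.len y := by
    unfold B9.Geometry.len
    exact mul_le_mul_of_nonneg_right (pow_le_pow_right₀ hL hj) hη.le
  exact inv_anti₀ (pow_pos hpos n) (pow_le_pow_left₀ hpos.le hle n)

/-- **(1.92) as printed, «for x ∈ Ω_j», with the Δ-entry**: under the hypotheses of `ineq192_blocks_op`, L ≧ 1, η > 0,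
for every v whose block has scale j(v) ≧ j (i.e. v ∈ Ω_j): |(H′X)(v)| ≦ B′₀N, |(∇H′X)(v)| ≦ B′₀(Lʲη)⁻¹N,
|(ΔH′X)(v)| ≦ B′₀(Lʲη)⁻²N, B′₀ = κ_H·c₁(1−α′) — «B′₀ is an absolute constant (depending on d and L only)» in the printed
sense (through B₀, B₁, κ_Q, Λ, c₁ of Theorems 3.1/3.2 and Lemma 2.1).
[cite: Balaban1985RegularSpaces, (1.92) pp.91–92, p.93 l.1–3; Balaban1985BackgroundPropagators, (3.41) p.397] -/
theorem ineq192_onOmega_op (blk : W → g.Site) (d : ℕ) (ρ α' κH N : ℝ) (hκH : 0 ≤ κH) (hN : 0 ≤ N)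
    (hαρ : 0 ≤ α' * ρ) (hdnn : ∀ a b : g.Site, 0 ≤ g.dist a b) (hL : 1 ≤ g.L) (hη : 0 < g.eta)
    (h261 : Ineq261 d (toB6 g R H) ρ (1 - α'))
    {Hp DHp LapHp : Module.End ℝ (W → ℝ)}
    (h0 : HasMajorant (g := toB6 g R H) blk Hp (fun a b => κH * Real.exp (-(ρ * g.dist a b))))
    (h1 : HasMajorant (g := toB6 g R H) blk DHp (fun a b => κH * (g.len a)⁻¹ * Real.exp (-(ρ * g.dist a b))))
    (h2 : HasMajorant (g := toB6 g R H) blk LapHp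
      (fun a b => κH * (g.len a ^ 2)⁻¹ * Real.exp (-(ρ * g.dist a b))))
    (X : W → ℝ) (hX : ∀ x, |X x| ≤ N) (j : ℕ) (v : W) (hv : j ≤ g.scale (blk v)) :
    |Hp X v| ≤ κH * B6.c1 d ρ (1 - α') * N ∧
      |DHp X v| ≤ κH * B6.c1 d ρ (1 - α') * (g.L ^ j * g.eta)⁻¹ * N ∧
      |LapHp X v| ≤ κH * B6.c1 d ρ (1 - α') * ((g.L ^ j * g.eta) ^ 2)⁻¹ * N := by
  have hL0 : 0 < g.L := lt_of_lt_of_le one_pos hL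
  have hlen : ∀ y : g.Site, 0 < g.len y := fun y => by
    unfold B9.Geometry.len
    exact mul_pos (pow_pos hL0 _) hη
  obtain ⟨b0, b1, b2⟩ := ineq192_blocks_op (R := R) (H := H) blk d ρ α' κH N hκH hN hαρ hdnn hlen h261 h0 h1 h2
    X hX v
  have hc : 0 ≤ κH * B6.c1 d ρ (1 - α') := mul_nonneg hκH (B6RandomWalk.c1_nonneg d ρ (1 - α'))
  have m1 : (g.len (blk v))⁻¹ ≤ (g.L ^ j * g.eta)⁻¹ := by
    simpa using inv_len_pow_le (g := g) hL hη hv 1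
  have m2 : (g.len (blk v) ^ 2)⁻¹ ≤ ((g.L ^ j * g.eta) ^ 2)⁻¹ := inv_len_pow_le (g := g) hL hη hv 2
  refine ⟨b0, b1.trans ?_, b2.trans ?_⟩
  · exact mul_le_mul_of_nonneg_right (mul_le_mul_of_nonneg_left m1 hc) hN
  · exact mul_le_mul_of_nonneg_right (mul_le_mul_of_nonneg_left m2 hc) hN

end Function

end Literature.MathematicalPhysics.QuantumFieldTheory.Balaban1983to89.B8Ineq192Op

end
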